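import Summits.ResolutionOfSingularities.ResolutionOfSingularities.Theorems.MarkedTransferCampaignW46TamePolar
import Mathlib.LinearAlgebra.Dual.Lemmas
import HarnessLib

/-!
# [OURS · L1 W4.6, rung (iv) «large characteristic»] Computing the tame directrix: it is spanned by the coefficient
# functionals of the polar map — the row space of the coefficient matrix of the first partials
# (cell res-hironaka, LADDER-RESOLUTION rung L, D-0089; slot W4.6, seat res-L1-s46-pv-7; host route MarkedTransfer,
# `--supports stmt-ResolutionOfSingularities-16155 --as helper`)

HONEST FRAMING. Nothing here is a statement of H. Hironaka's manuscript (2017-03-23, [Hironaka2017]) and nothing here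
asserts that any statement of it holds. Linear algebra over the TREE's `Resolution.directrix k S ⊆ (k^d)^∨` (the
annihilator of Hironaka's invariance space `𝕎(S)`) and this seat's `TamePolar` (p481074: `𝕎({F}) = ker(polar)` in tame
degree). No premise of the manuscript, no FACT-LIST premise. AI review is weaker than expert review. No `sorry`, no
definition; axioms standard.

## What is proved (a recipe for the census instruments that compute `τ`)

For `F ∈ k[Y_1, …, Y_d]` with `1, …, deg F` non-zero in `k` (characteristic `0`, or `p > deg F`), with the polar map
`polar_F : k^d → k[Y]`, `w ↦ Σ_i w_i ∂F/∂Y_i`: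

* `directrix_singleton_eq_dualAnnihilator_ker_polar` — `T({F}) = (ker polar_F)^0`;
* `directrix_singleton_eq_range_dualMap_polar` — `T({F}) = range (polar_F^∨)`: the directrix consists of the functionals
  `w ↦ φ(∂_w F)`, `φ ∈ k[Y]^∨`;
* `coeffPolar_mem_directrix` / `directrix_singleton_eq_span_coeffPolar` — **it is SPANNED by the coefficient functionals**
  `ℓ_m : w ↦ coeff_m(∂_w F) = Σ_i w_i · coeff_m(∂F/∂Y_i)`, `m` ranging over the monomials (of degree `deg F − 1`): the
  directrix of a tame form is the ROW SPACE of the `d × N` coefficient matrix of its first partials, and `τ(F)` is the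
  rank of that matrix (`TamePolar.hironakaTau_singleton_eq_finrank_span_pderiv`). In characteristic `p ≤ deg F` this
  recipe under-counts (`TamePolar.hironakaTau_X_pow_char_ne_finrank_span_pderiv`).

## References (context)

* Berthomieu–Hivert–Mourtada 2010, Algorithm 3.5 (characteristic `0`: the linear `D_A f` are read off the coefficients
  of `f(X + X')`). [cite: BerthomieuHivertMourtada2010, Algorithm 3.5]
* Cossart–Piltant 2008, proof of Prop. 4.2 (`T(S)`, `τ`). [cite: CossartPiltant2008, proof of Prop. 4.2]
-/

noncomputable section

set_option linter.dupNamespace false -- mandated namespace of this single-conjunct summit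

namespace Summit.ResolutionOfSingularities.ResolutionOfSingularities.Theorems
namespace CampaignW46
namespace TameDirectrixSpan

open MvPolynomial
open Literature.AlgebraicGeometry.Resolution

universe u

variable (k : Type u) [Field k] {d : ℕ}

/-- [OURS · L1 W4.6 (iv); NOT a statement of the manuscript] **`T({F}) = (ker polar_F)^0`** in tame degree: the
directrix (tree: the annihilator of the invariance space) is the annihilator of the polar kernel. [folklore] -/
theorem directrix_singleton_eq_dualAnnihilator_ker_polar (F : MvPolynomial (Fin d) k)
    (hchar : ∀ m : ℕ, 1 ≤ m → m ≤ F.totalDegree → (m : k) ≠ 0) :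
    directrix k ({F} : Set (MvPolynomial (Fin d) k)) =
      (LinearMap.ker (Fintype.linearCombination k fun i : Fin d => pderiv i F)).dualAnnihilator := by
  rw [directrix, TamePolar.invarianceSpace_singleton_eq_ker_polar k F hchar]

/-- [OURS · L1 W4.6 (iv); NOT a statement of the manuscript] **`T({F}) = range (polar_F^∨)`** in tame degree: the
directrix consists exactly of the functionals `w ↦ φ(Σ_i w_i ∂_i F)` for `φ ∈ k[Y]^∨`. [folklore] -/
theorem directrix_singleton_eq_range_dualMap_polar (F : MvPolynomial (Fin d) k)
    (hchar : ∀ m : ℕ, 1 ≤ m → m ≤ F.totalDegree → (m : k) ≠ 0) :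
    directrix k ({F} : Set (MvPolynomial (Fin d) k)) =
      LinearMap.range (Fintype.linearCombination k fun i : Fin d => pderiv i F).dualMap := by
  rw [directrix_singleton_eq_dualAnnihilator_ker_polar k F hchar, LinearMap.range_dualMap_eq_dualAnnihilator_ker]

/-- The polar map `w ↦ Σ_i w_i ∂_i F` followed by the `m`-th coefficient: the functional
`ℓ_m(w) = Σ_i w_i · coeff_m(∂F/∂Y_i)` (a row-space element of the coefficient matrix of the partials). [folklore] -/
theorem lcoeff_comp_polar_apply (F : MvPolynomial (Fin d) k) (m : Fin d →₀ ℕ) (w : Fin d → k) :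
    ((lcoeff k m).comp (Fintype.linearCombination k fun i : Fin d => pderiv i F)) w =
      ∑ i, w i * coeff m (pderiv i F) := by
  rw [LinearMap.comp_apply, Fintype.linearCombination_apply, lcoeff_apply, coeff_sum]
  exact Finset.sum_congr rfl fun i _ => by rw [coeff_smul, smul_eq_mul]

/-- [OURS · L1 W4.6 (iv)] Each coefficient functional `ℓ_m : w ↦ Σ_i w_i coeff_m(∂_i F)` lies in the directrix of a
tame form. [folklore] -/
theorem coeffPolar_mem_directrix (F : MvPolynomial (Fin d) k)
    (hchar : ∀ m : ℕ, 1 ≤ m → m ≤ F.totalDegree → (m : k) ≠ 0) (m : Fin d →₀ ℕ) :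
    (lcoeff k m).comp (Fintype.linearCombination k fun i : Fin d => pderiv i F) ∈
      directrix k ({F} : Set (MvPolynomial (Fin d) k)) := by
  rw [directrix_singleton_eq_range_dualMap_polar k F hchar]
  exact ⟨lcoeff k m, rfl⟩

/-- [OURS · L1 W4.6 (iv); NOT a statement of the manuscript] **The tame directrix is the row space of the coefficient
matrix of the first partials**: `T({F}) = span_k {ℓ_m : m}` with `ℓ_m(w) = Σ_i w_i coeff_m(∂F/∂Y_i)` (only the
monomials `m` occurring in some `∂_i F` contribute). Hence `τ(F) = rank` of that matrix
(`TamePolar.hironakaTau_singleton_eq_finrank_span_pderiv`). [folklore] -/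
theorem directrix_singleton_eq_span_coeffPolar (F : MvPolynomial (Fin d) k)
    (hchar : ∀ m : ℕ, 1 ≤ m → m ≤ F.totalDegree → (m : k) ≠ 0) :
    directrix k ({F} : Set (MvPolynomial (Fin d) k)) =
      Submodule.span k (Set.range fun m : Fin d →₀ ℕ =>
        (lcoeff k m).comp (Fintype.linearCombination k fun i : Fin d => pderiv i F)) := by
  classical
  apply le_antisymm
  · rw [directrix_singleton_eq_range_dualMap_polar k F hchar]
    rintro _ ⟨φ, rfl⟩
    -- `φ ∘ polar = Σ_{m ∈ S} φ(X^m) • ℓ_m` for the finite set `S` of monomials of the partials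
    set f := Fintype.linearCombination k fun i : Fin d => pderiv i F with hf
    set S : Finset (Fin d →₀ ℕ) := Finset.univ.biUnion fun i : Fin d => (pderiv i F).support with hS
    have hsupp : ∀ w : Fin d → k, (f w).support ⊆ S := by
      intro w
      rw [hf, Fintype.linearCombination_apply]
      refine (support_sum).trans (Finset.biUnion_subset.mpr fun i _ => ?_)
      exact (support_smul).trans (Finset.subset_biUnion_of_mem (fun i => (pderiv i F).support) (Finset.mem_univ i))
    have key : f.dualMap φ = ∑ m ∈ S, φ (monomial m 1) • (lcoeff k m).comp f := by
      refine LinearMap.ext fun w => ?_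
      rw [LinearMap.dualMap_apply, LinearMap.coe_sum, Finset.sum_apply]
      conv_lhs => rw [(f w).as_sum, Finset.sum_subset (hsupp w) (fun m _ hm => by
        rw [notMem_support_iff.mp hm, map_zero])]
      rw [map_sum]
      refine Finset.sum_congr rfl fun m _ => ?_
      rw [LinearMap.smul_apply, LinearMap.comp_apply, lcoeff_apply, smul_eq_mul, mul_comm, ← smul_eq_mul,
        ← map_smul, smul_monomial, smul_eq_mul, mul_one]
    rw [key]
    exact Submodule.sum_mem _ fun m _ => Submodule.smul_mem _ _ (Submodule.subset_span ⟨m, rfl⟩)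
  · exact Submodule.span_le.mpr (by rintro _ ⟨m, rfl⟩; exact coeffPolar_mem_directrix k F hchar m)

/-- [OURS · L1 W4.6 (iv)] **Characteristic `p > deg F`** version of the row-space recipe. [folklore] -/
theorem directrix_singleton_eq_span_coeffPolar_of_lt_char (p : ℕ) [CharP k p] (F : MvPolynomial (Fin d) k)
    (hF : F.totalDegree < p) :
    directrix k ({F} : Set (MvPolynomial (Fin d) k)) =
      Submodule.span k (Set.range fun m : Fin d →₀ ℕ =>
        (lcoeff k m).comp (Fintype.linearCombination k fun i : Fin d => pderiv i F)) :=
  directrix_singleton_eq_span_coeffPolar k F (TamePolar.natCast_ne_zero_of_lt_char p hF)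

end TameDirectrixSpan
end CampaignW46
end Summit.ResolutionOfSingularities.ResolutionOfSingularities.Theorems

end
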